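import Literature.MathematicalPhysics.QuantumFieldTheory.Balaban1983to89.B8Eq191FlatStencils
import Literature.MathematicalPhysics.QuantumFieldTheory.Balaban1983to89.B7Prop3GeneralRotated

/-!
# `Balaban1983to89.B9B8AveragingKernelZd` — JUNCTION J-B, FILE 0 (knit side): [Balaban1985BackgroundPropagators] (3.19) — THE ITERATED COVARIANT
# AVERAGING `Q′_j(U) = Q′(Ūʲ⁻¹)⋯Q′(Ū)Q′(U)` OF THE `ℤᵈ` KNIT (`B7Eq78Linearization.QprimeIter (zdBlocking d L) T j`) IS ONE KERNEL ON THE `Lʲ`-BLOCK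
# WITH THE COMPOSITE TRANSPORTER: `(Q′_jλ)(y) = Σ_{x ∈ Bʲ(y)} L^{−jd} R(T^{(j)}(y, x)) λ(x)`, and its flat face

statement-level skeleton of published theorems with citation tags; proofs where landed; nothing here is a claim about the
Yang–Mills mass gap

T. Bałaban, *Propagators for lattice gauge theories in a background field*, Commun. Math. Phys. **99** (1985) 389–434
[`Balaban1985BackgroundPropagators`, "[B9]"; PDF held `paper:balaban1985-cmp99-background-propagators`, journal page = PDF page + 388];
T. Bałaban, *Averaging operations for lattice gauge theories*, Commun. Math. Phys. **98** (1985) 17–51 [`Balaban1985Averaging`, "[5]"].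

THE PRINT (verbatim, [B9] p. 393 (3.19), text layer p0005 re-read by this seat): *«(Q′_j(U)λ)(y) = (Q(Ūʲ⁻¹) … Q(Ū)Q(U)λ)(y) =
Σ_{x∈Bʲ(y)} L^{−jd} R(U(Γ^{(j)}_{y,x})) λ(x), y ∈ T^{(j)}_{Lʲη}. (3.19)  The contours Γ^{(j)}_{y,x}, x ∈ Bʲ(y), and the contour variables U(Γ^{(j)}_{y,x})
were defined by (52), (53) in [5].»*  The first form is the tree's `QprimeIter` (recursion `Q′_{j+1} = Q′(T_j) ∘ Q′_j` with the one-step averaging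
`B7Eq78Linearization.Qprime` over the blocks `QuantumLattice.blockSites L y` of the scaled `ℤᵈ` lattices, transporters `T j y x`); THIS FILE proves
the second form: the `j`-fold operator is ONE sum over the `Lʲ`-block with the COMPOSITE transporter `T^{(j)}(y, x) = T_{j−1}(y, x_{j−1}) ·
T_{j−2}(x_{j−1}, x_{j−2}) ⋯ T₀(x₁, x)` along the chain of block ancestors `x ↦ x₁ ↦ … ↦ x_{j−1} ↦ y` — print's composite contour (52)–(53).

CITATION HEADER (lean-in-tree rule).  Cell `lit-balaban`, sub-row G-B9-LETTERS, junction J-B of the lead's RULING #3 (2026-08-28T01:14Z) → seat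
`lit-balaban-p33` gen 91; statement list `lit-balaban-p33/JAB-STATEMENTS.md` v1 §3 (a), «RISKS: the j-fold unfolded kernel of `QprimeIter (zdBlocking)`»
— this file removes that risk.  USE: the composite transporter `compT` is the datum from which J-B's `parKnitY` (def-Y's operator layer re-instantiated AT
THE KNIT'S TRANSPORTER) is built; the flat face (`T ≡ 1`) is the kernel both carriers share at `U = 1` (def-Y's `qpK = QM`, weight `L^{−jd}` on the block).

WHAT IS PROVED (sorry-free; two definitions with bodies — the iterated block `blockIter` and the composite transporter `compT` — and theorems).
* §1 `conjR` bookkeeping BY NAME (`conjR_mul_left`, `conjR_unitOne`, `conjR_sum` of the [B7]∕[B8] files).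
* §2 the ITERATED BLOCK `blockIter L j y` (`= Bʲ(y)`, the `Lʲᵈ` level-0 sites under the level-`j` site `y` in scaled coordinates), membership
  `x ∈ Bʲ(y) ↔ blockMap^[j] x = y` (`mem_blockIter_iff`), pairwise disjointness of the sub-blocks.
* §3 the COMPOSITE TRANSPORTER `compT L T j y x` (recursion on `j` through the ancestor `blockMap^[j] x`) and ★★★ `QprimeIter_zd_eq_sum_blockIter`:
  `QprimeIter (zdBlocking d L) T j μ y = Σ_{x ∈ blockIter L j y} ((Lᵈ)⁻¹)^j • conjR (compT L T j y x) (μ x)` — (3.19)'s second form.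
* §4 the FLAT FACE: for `T ≡ 1`, `QprimeIter … j μ y = ((Lᵈ)⁻¹)^j • Σ_{x ∈ Bʲ(y)} μ x` (`QprimeIter_zd_one_eq`).

HONEST SCOPE.  Bookkeeping identities of the knit's own letters on `ℤᵈ` (any `L ≥ 1`, any transporter family, any coefficient algebra); no
estimate of [5]∕[B9]; no carrier is crossed here (that is J-A ∕ J-B file 1).  Count-neutral; nothing continuum, nothing about OS axioms or the mass
gap.  No `sorry`, no `axiom`, no `instance`, no `notation`.  Seat `lit-balaban-p33` gen 91 (literature-prover), 2026-08-28.
-/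

noncomputable section

namespace Literature.MathematicalPhysics.QuantumFieldTheory.Balaban1983to89.B9B8AveragingKernelZd

open Finset
open Literature.MathematicalPhysics.QuantumLattice (blockSites blockBase blockMap mem_blockSites_iff card_blockSites)
open B7Eq78Linearization (conjR conjR_apply conjR_add conjR_smul_real Qprime Qprime_apply QprimeIter QprimeIter_succ zdBlocking Blocking)
open B7Prop3GeneralRotated (conjR_mul_left)
open B8Eq191FlatStencils (conjR_unitOne)
open B8Ineq132 (conjR_sum)

variable {𝔸 : Type*} [NormedRing 𝔸] [NormedAlgebra ℂ 𝔸]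
variable {d : ℕ}

/-! ## §1 `conjR` bookkeeping — in the tree: `B7Prop3GeneralRotated.conjR_mul_left` (`R(XY) = R(X)R(Y)`), `B8Eq191FlatStencils.conjR_unitOne`
(`R(1) = id`), `B8Ineq132.conjR_sum` (`R(X)` through finite sums); used by name below. -/

/-! ## §2 The iterated block `Bʲ(y)` in scaled coordinates -/

section Blocks

/-- **THE ITERATED BLOCK `Bʲ(y)`**: the level-0 sites under the level-`j` site `y` of the scaled lattices (`B⁰(y) = {y}`, `B^{j+1}(y) =
⋃_{x₁ ∈ B(y)} Bʲ(x₁)`). [cite: Balaban1985BackgroundPropagators, (3.19) p.393 («x ∈ Bʲ(y)»); Balaban1985Averaging, (52)–(53) p.27] -/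
def blockIter (L : ℕ) : ℕ → (Fin d → ℤ) → Finset (Fin d → ℤ)
  | 0, y => {y}
  | j + 1, y => (blockSites L y).biUnion fun x₁ => blockIter L j x₁

/-- `B⁰(y) = {y}`. [cite: Balaban1985BackgroundPropagators, (3.19) p.393, bookkeeping] -/
@[simp] theorem blockIter_zero (L : ℕ) (y : Fin d → ℤ) : blockIter L 0 y = {y} := rfl

/-- the recursion of `Bʲ(y)`. [cite: Balaban1985BackgroundPropagators, (3.19) p.393, bookkeeping] -/
theorem blockIter_succ (L j : ℕ) (y : Fin d → ℤ) : blockIter L (j + 1) y = (blockSites L y).biUnion fun x₁ => blockIter L j x₁ := rfl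

/-- ★ **MEMBERSHIP**: `x ∈ Bʲ(y) ↔ y` is the `j`-th block ancestor of `x` (`blockMap^[j] x = y`). [cite: Balaban1985BackgroundPropagators, (3.19) p.393; Balaban1985Averaging, (52)–(53) p.27] -/
theorem mem_blockIter_iff (L : ℕ) [NeZero L] : ∀ (j : ℕ) (y x : Fin d → ℤ), x ∈ blockIter L j y ↔ (blockMap L)^[j] x = y
  | 0, y, x => by simp [Function.iterate_zero]
  | j + 1, y, x => by
      rw [blockIter_succ, mem_biUnion]
      constructor
      · rintro ⟨x₁, hx₁, hx⟩
        rw [Function.iterate_succ_apply', (mem_blockIter_iff L j x₁ x).1 hx]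
        exact (mem_blockSites_iff L y x₁).1 hx₁
      · intro h
        refine ⟨(blockMap L)^[j] x, ?_, (mem_blockIter_iff L j _ x).2 rfl⟩
        rw [mem_blockSites_iff]
        rwa [Function.iterate_succ_apply'] at h

/-- the sub-blocks `Bʲ(x₁)`, `x₁ ∈ B(y)`, are pairwise disjoint. [cite: Balaban1985Averaging, (52)–(53) p.27, bookkeeping] -/
theorem blockIter_pairwiseDisjoint (L : ℕ) [NeZero L] (j : ℕ) (s : Finset (Fin d → ℤ)) :
    (s : Set (Fin d → ℤ)).PairwiseDisjoint fun x₁ => blockIter L j x₁ := by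
  intro a _ b _ hab
  rw [Function.onFun, Finset.disjoint_left]
  intro x ha hb
  exact hab (((mem_blockIter_iff L j a x).1 ha).symm.trans ((mem_blockIter_iff L j b x).1 hb))

/-- `Bʲ(y)` has `L^{jd}` sites. [cite: Balaban1985BackgroundPropagators, (3.19) p.393 («L^{−jd}»)] -/
theorem card_blockIter (L : ℕ) [NeZero L] : ∀ (j : ℕ) (y : Fin d → ℤ), (blockIter L j y).card = (L ^ d) ^ j
  | 0, y => by simp
  | j + 1, y => by
      rw [blockIter_succ, card_biUnion (blockIter_pairwiseDisjoint L j _)]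
      simp only [card_blockIter L j, sum_const, card_blockSites, smul_eq_mul]
      ring

end Blocks

/-! ## §3 The composite transporter and (3.19)'s second form -/

section Composite

/-- **THE COMPOSITE TRANSPORTER `T^{(j)}(y, x)`** of (3.19) ∕ [5] (52)–(53): `T^{(0)} = 1`, `T^{(j+1)}(y, x) = T_j(y, x_j) · T^{(j)}(x_j, x)` with
`x_j = blockMap^[j] x` the level-`j` ancestor of `x` (the leg on the coarsest lattice first, as in `R(U(Γ^{(j)}_{y,x}))` read outward from `y`).
[cite: Balaban1985BackgroundPropagators, (3.19) p.393; Balaban1985Averaging, (52)–(53) p.27] -/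
def compT (L : ℕ) (T : ℕ → (Fin d → ℤ) → (Fin d → ℤ) → 𝔸ˣ) : ℕ → (Fin d → ℤ) → (Fin d → ℤ) → 𝔸ˣ
  | 0, _, _ => 1
  | j + 1, y, x => T j y ((blockMap L)^[j] x) * compT L T j ((blockMap L)^[j] x) x

omit [NormedAlgebra ℂ 𝔸] in
/-- `T^{(0)} = 1`. [cite: Balaban1985BackgroundPropagators, (3.19) p.393, bookkeeping] -/
@[simp] theorem compT_zero (L : ℕ) (T : ℕ → (Fin d → ℤ) → (Fin d → ℤ) → 𝔸ˣ) (y x : Fin d → ℤ) : compT L T 0 y x = 1 := rfl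

omit [NormedAlgebra ℂ 𝔸] in
/-- the recursion of `T^{(j)}`. [cite: Balaban1985BackgroundPropagators, (3.19) p.393, bookkeeping] -/
theorem compT_succ (L : ℕ) (T : ℕ → (Fin d → ℤ) → (Fin d → ℤ) → 𝔸ˣ) (j : ℕ) (y x : Fin d → ℤ) :
    compT L T (j + 1) y x = T j y ((blockMap L)^[j] x) * compT L T j ((blockMap L)^[j] x) x := rfl

omit [NormedAlgebra ℂ 𝔸] in
/-- `T^{(1)}(y, x) = T₀(y, x)`: one level is one leg. [cite: Balaban1985BackgroundPropagators, (3.19) p.393, bookkeeping] -/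
theorem compT_one (L : ℕ) (T : ℕ → (Fin d → ℤ) → (Fin d → ℤ) → 𝔸ˣ) (y x : Fin d → ℤ) : compT L T 1 y x = T 0 y x := by
  rw [compT_succ, Function.iterate_zero, id, compT_zero, mul_one]

omit [NormedAlgebra ℂ 𝔸] in
/-- with trivial legs the composite transporter is trivial. [cite: Balaban1985BackgroundPropagators, Cor. 3.5 p.407 (U = 1), bookkeeping] -/
@[simp] theorem compT_one_legs (L : ℕ) : ∀ (j : ℕ) (y x : Fin d → ℤ), compT L (fun _ _ _ => (1 : 𝔸ˣ)) j y x = 1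
  | 0, _, _ => rfl
  | j + 1, y, x => by rw [compT_succ, compT_one_legs L j, one_mul]

/-- ★★★ **(3.19), SECOND FORM, FOR THE KNIT's LETTER**: the `j`-fold covariant average of the `ℤᵈ` blocking is ONE kernel on the `Lʲ`-block with
the composite transporter — `(Q′_jμ)(y) = Σ_{x ∈ Bʲ(y)} (L⁻ᵈ)ʲ · R(T^{(j)}(y, x)) μ(x)`. [cite: Balaban1985BackgroundPropagators, (3.19) p.393; Balaban1985Averaging, (52)–(53) p.27, (78) p.30] -/
theorem QprimeIter_zd_eq_sum_blockIter (L : ℕ) [NeZero L] (T : ℕ → (Fin d → ℤ) → (Fin d → ℤ) → 𝔸ˣ) :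
    ∀ (j : ℕ) (μ : (Fin d → ℤ) → 𝔸) (y : Fin d → ℤ),
      QprimeIter (zdBlocking d L) T j μ y = ∑ x ∈ blockIter L j y, ((((L : ℝ) ^ d)⁻¹) ^ j) • conjR (compT L T j y x) (μ x)
  | 0, μ, y => by simp [QprimeIter]
  | j + 1, μ, y => by
      rw [QprimeIter_succ, Qprime_apply, blockIter_succ, sum_biUnion (blockIter_pairwiseDisjoint L j _)]
      refine sum_congr rfl fun x₁ hx₁ => ?_
      have hB : (zdBlocking d L).B j y = blockSites L y := rfl
      have hwt : (zdBlocking d L).wt j y x₁ = (((L : ℝ) ^ d)⁻¹) := rfl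
      rw [hwt, QprimeIter_zd_eq_sum_blockIter L T j μ x₁, conjR_sum, smul_sum]
      refine sum_congr rfl fun x hx => ?_
      have hanc : (blockMap L)^[j] x = x₁ := (mem_blockIter_iff L j x₁ x).1 hx
      rw [conjR_smul_real, smul_smul, compT_succ, hanc, conjR_mul_left, pow_succ, mul_comm]

/-- ★ (3.19) at one level: `(Q′₁μ)(y) = Σ_{x ∈ B(y)} L⁻ᵈ R(T₀(y, x)) μ(x)` (the one-step `Qprime`). [cite: Balaban1985BackgroundPropagators, (3.18)–(3.19) p.393] -/
theorem QprimeIter_zd_one_level (L : ℕ) [NeZero L] (T : ℕ → (Fin d → ℤ) → (Fin d → ℤ) → 𝔸ˣ) (μ : (Fin d → ℤ) → 𝔸) (y : Fin d → ℤ) :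
    QprimeIter (zdBlocking d L) T 1 μ y = ∑ x ∈ blockSites L y, (((L : ℝ) ^ d)⁻¹) • conjR (T 0 y x) (μ x) := by
  rw [QprimeIter_zd_eq_sum_blockIter, blockIter_succ]
  have hb : ((blockSites L y).biUnion fun x₁ => blockIter L 0 x₁) = blockSites L y := by
    ext x; simp
  rw [hb]
  refine sum_congr rfl fun x _ => ?_
  rw [pow_one, compT_one]

end Composite

/-! ## §4 The flat face `T ≡ 1` -/

section Flat

/-- ★ **THE FLAT `j`-FOLD AVERAGE**: with trivial transporters `(Q′_jμ)(y) = (L⁻ᵈ)ʲ Σ_{x ∈ Bʲ(y)} μ(x)` — the plain block mean over the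
`L^{jd}` sites of `Bʲ(y)` (the kernel def-Y's `qpK = QM` carries on the box chart). [cite: Balaban1985BackgroundPropagators, (3.19) p.393, Cor. 3.5 p.407 (U = 1); Balaban1984PropagatorsII, (2.14) p.225] -/
theorem QprimeIter_zd_one_eq (L : ℕ) [NeZero L] (j : ℕ) (μ : (Fin d → ℤ) → 𝔸) (y : Fin d → ℤ) :
    QprimeIter (zdBlocking d L) (fun _ _ _ => (1 : 𝔸ˣ)) j μ y = ((((L : ℝ) ^ d)⁻¹) ^ j) • ∑ x ∈ blockIter L j y, μ x := by
  rw [QprimeIter_zd_eq_sum_blockIter, smul_sum]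
  refine sum_congr rfl fun x _ => ?_
  rw [compT_one_legs, conjR_unitOne]

/-- the flat average of a constant is the constant (the weights are normalised: `L^{jd}` sites of weight `L^{−jd}`).
[cite: Balaban1985Averaging, (78) p.30 («Σ L⁻ᵈ = 1»); Balaban1985BackgroundPropagators, (3.19) p.393] -/
theorem QprimeIter_zd_one_const (L : ℕ) [NeZero L] (j : ℕ) (c : 𝔸) (y : Fin d → ℤ) :
    QprimeIter (zdBlocking d L) (fun _ _ _ => (1 : 𝔸ˣ)) j (fun _ => c) y = c := by
  rw [QprimeIter_zd_one_eq, sum_const, card_blockIter, ← Nat.cast_smul_eq_nsmul ℝ, smul_smul]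
  have hL : ((L : ℝ) ^ d) ≠ 0 := by
    have : (L : ℝ) ≠ 0 := by exact_mod_cast NeZero.ne L
    positivity
  have h1 : (((L : ℝ) ^ d)⁻¹) ^ j * (((L ^ d) ^ j : ℕ) : ℝ) = 1 := by
    push_cast
    rw [← mul_pow, inv_mul_cancel₀ hL, one_pow]
  rw [h1, one_smul]

end Flat

end Literature.MathematicalPhysics.QuantumFieldTheory.Balaban1983to89.B9B8AveragingKernelZd

end
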